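import Summits.QuantumFields.YangMills.Theorems.ColdStartUniversalityLatticeLangevinLiebRobinsonPlaquetteSmallCoupling
import Literature.MathematicalPhysics.QuantumFieldTheory.HaarMomentsSUN
import HarnessLib

/-!
# Route `ColdStartUniversality` (fixed-cut-off SZZ dynamics; LIEB–ROBINSON / LOCALITY package, file 28):
# ★★ THE STRONG-COUPLING SLOPE OF THE PLAQUETTE IS EXACTLY `1` AND THE SPECIFIC HEAT AT `β' = 0` IS EXACTLY `1` PER PLAQUETTE, EVERY `L ≥ 2`

Helper file (seat `ym-line-csu-p1`, g31; `--supports stmt-QuantumFields-24809`).  The first coefficient of the strong-coupling expansion, with NO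
finite-volume correction: for the `SU(2)` Wilson measure `μ_b ∝ exp(b Σ_q Re tr U_q)·Haar^⊗E` on `(ℤ/L)³`, `L ≥ 2`,
* `integral_plaquette_mul_pi_eq_zero_of_update` — `∫ Re tr U_p · Φ dHaar^⊗E = 0` for every measurable `Φ` blind to the link `(x, i)` of `p` (centre flip, file 26);
* `integral_plaquette_mul_plaquette_pi_eq_zero` — **distinct plaquettes are Haar-orthogonal**: `∫ Re tr U_p · Re tr U_q dHaar^⊗E = 0`, `p ≠ q`
  (a plaquette `q ≠ p` misses the link `(x, i)` or the link `(x, j)` of `p = (x; i < j)`);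
* `integral_plaquette_sq_pi_eq_one` — `∫ (Re tr U_p)² dHaar^⊗E = 1` (`U_p` is Haar distributed: skew-product invariance
  `measurePreserving_update_mul_pi`; `∫ (Re tr U)² dU = 1`, the tree's `charVariance_eq_one`);
* ★★ `hasDerivAt_plaquette_expectation_zero` — **`d/db|_(b=0) ⟨Re tr U_p⟩_(μ_b) = 1` for every `L ≥ 2` and every plaquette** (first cumulant
  `−Cov_Haar(Re tr U_p, S_W)`, file 21, and the three facts above);
* ★★ `hasDerivAt_meanAction_zero` — **`d/db|_(b=0) ⟨S_W⟩_(μ_b) = −#𝒫 = −3L³`**: the specific heat per plaquette at infinite temperature is exactly `1`,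
  every `L ≥ 2` (`Var_Haar(S_W) = #𝒫` by orthogonality).
Together with files 26–27 (`⟨Re tr U_p⟩_(β') = O(β')` uniformly in `L`) this is the order-one strong-coupling picture, kernel-checked on every torus.
THEOREMS ONLY, no definition, no sorry; [folklore; cite: Wilson1974, §III].  HONEST FRAMING: fixed cut-off; a statement AT `β' = 0` (plus the
volume-uniform Lipschitz bounds of file 21 near it); nothing about `β'_K → ∞`; `UniformColdStartMixing` (24809) is NOT restated; no crux, rung or
summit statement is proved; the Yang–Mills mass gap is NOT proved.
-/

set_option autoImplicit false

noncomputable section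

namespace Summit.QuantumFields.YangMills.Theorems.ColdStartUniversality.LiebRobinson

open MeasureTheory ProbabilityTheory Matrix Complex Finset Filter Set Metric Function
open scoped ComplexConjugate BigOperators Matrix NNReal ENNReal Topology
open Literature.Probability.Process Literature.MathematicalPhysics.QuantumFieldTheory
open Literature.MathematicalPhysics.QuantumFieldTheory.Balaban1983to89
open Literature.MathematicalPhysics.QuantumLattice (fundamentalRep fundamentalLatticeRep continuous_fundamentalRep fundamentalRep_apply)

variable {L : ℕ} [NeZero L]

omit [NeZero L] in
/-- Reversing the orientation of a plaquette inverts its holonomy: `U_(x;j,i) = U_(x;i,j)⁻¹`. [folklore] -/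
theorem plaquetteHolonomy_swap (U : GaugeConfig 3 L (Matrix.specialUnitaryGroup (Fin 2) ℂ))
    (x : Literature.MathematicalPhysics.QuantumFieldTheory.Site 3 L) (i j : Fin 3) :
    plaquetteHolonomy U x j i = (plaquetteHolonomy U x i j)⁻¹ := by
  unfold plaquetteHolonomy
  group

omit [NeZero L] in
/-- `Re tr ρ(U_(x;j,i)) = Re tr ρ(U_(x;i,j))` (`ρ(U⁻¹) = ρ(U)ᴴ` on `SU(2)`). [folklore] -/
theorem re_trace_plaquetteHolonomy_swap (U : GaugeConfig 3 L (Matrix.specialUnitaryGroup (Fin 2) ℂ))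
    (x : Literature.MathematicalPhysics.QuantumFieldTheory.Site 3 L) (i j : Fin 3) :
    ((fundamentalRep (Fin 2) (plaquetteHolonomy U x j i) : Matrix (Fin 2) (Fin 2) ℂ)).trace.re =
      ((fundamentalRep (Fin 2) (plaquetteHolonomy U x i j) : Matrix (Fin 2) (Fin 2) ℂ)).trace.re := by
  have hinv : ∀ V : Matrix.specialUnitaryGroup (Fin 2) ℂ,
      (fundamentalRep (Fin 2) V⁻¹ : Matrix (Fin 2) (Fin 2) ℂ) = (fundamentalRep (Fin 2) V : Matrix (Fin 2) (Fin 2) ℂ)ᴴ := fun V => by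
    rw [← Matrix.star_eq_inv]; rfl
  rw [plaquetteHolonomy_swap, hinv, Matrix.trace_conjTranspose, Complex.star_def, Complex.conj_re]

omit [NeZero L] in
/-- On a torus of side `L ≥ 2`, shifts in different directions differ: `x + eᵢ ≠ x + eⱼ` for `i ≠ j`. [folklore] -/
theorem site_shift_ne_shift (hL : 1 < L) (x : Literature.MathematicalPhysics.QuantumFieldTheory.Site 3 L) {i j : Fin 3} (hij : i ≠ j) :
    Literature.MathematicalPhysics.QuantumFieldTheory.Site.shift x i ≠ Literature.MathematicalPhysics.QuantumFieldTheory.Site.shift x j := by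
  haveI : Fact (1 < L) := ⟨hL⟩
  intro h
  have h1 : (Pi.single i (1 : ZMod L) : Fin 3 → ZMod L) = Pi.single j 1 := by
    have h' := congrArg (fun y => y - x) h
    simp only [Literature.MathematicalPhysics.QuantumFieldTheory.Site.shift, add_sub_cancel_left] at h'
    exact h'
  have h2 := congrFun h1 i
  rw [Pi.single_eq_same, Pi.single_eq_of_ne hij] at h2
  exact one_ne_zero h2

omit [NeZero L] in
/-- On a torus of side `L ≥ 2`, `x + eⱼ ≠ x`. [folklore] -/
theorem site_shift_ne_self (hL : 1 < L) (x : Literature.MathematicalPhysics.QuantumFieldTheory.Site 3 L) (j : Fin 3) :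
    Literature.MathematicalPhysics.QuantumFieldTheory.Site.shift x j ≠ x := by
  haveI : Fact (1 < L) := ⟨hL⟩
  intro h
  have h1 : (Pi.single j (1 : ZMod L) : Fin 3 → ZMod L) = 0 := by
    have h' := congrArg (fun y => y - x) h
    simp only [Literature.MathematicalPhysics.QuantumFieldTheory.Site.shift, add_sub_cancel_left, sub_self] at h'
    exact h'
  have h2 := congrFun h1 j
  rw [Pi.single_eq_same, Pi.zero_apply] at h2
  exact one_ne_zero h2

/-- ★ **A plaquette is Haar-orthogonal to everything blind to one of its links**: for `1 < L`, `i ≠ j` and every measurable `Φ` with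
`Φ(update U (x,i) g) = Φ(U)`, `∫ Re tr ρ(U_(x;i,j)) · Φ(U) dHaar^⊗E = 0` (flip the link `(x, i)` by the centre element `−1`). [folklore] -/
theorem integral_plaquette_mul_pi_eq_zero_of_update (L : ℕ) [NeZero L] (hL : 1 < L) (x : Literature.MathematicalPhysics.QuantumFieldTheory.Site 3 L)
    {i j : Fin 3} (hij : i ≠ j) {Φ : GaugeConfig 3 L (Matrix.specialUnitaryGroup (Fin 2) ℂ) → ℝ} (hΦm : Measurable Φ)
    (hΦ : ∀ (U : GaugeConfig 3 L (Matrix.specialUnitaryGroup (Fin 2) ℂ)) (g : Matrix.specialUnitaryGroup (Fin 2) ℂ), Φ (update U (x, i) g) = Φ U) :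
    ∫ U, ((fundamentalRep (Fin 2) (plaquetteHolonomy U x i j) : Matrix (Fin 2) (Fin 2) ℂ)).trace.re * Φ U
      ∂(Measure.pi fun _ : Edge 3 L => haarProbability (Matrix.specialUnitaryGroup (Fin 2) ℂ)) = 0 := by
  classical
  haveI := secondCountableTopology_su2
  haveI := borelSpace_config L
  haveI : Fact (1 < L) := ⟨hL⟩
  have hmem : (-1 : Matrix (Fin 2) (Fin 2) ℂ) ∈ Matrix.specialUnitaryGroup (Fin 2) ℂ := by
    rw [Matrix.mem_specialUnitaryGroup_iff]
    refine ⟨?_, ?_⟩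
    · rw [Matrix.mem_unitaryGroup_iff]; simp
    · rw [Matrix.det_neg, Matrix.det_one]; simp
  let c : Matrix.specialUnitaryGroup (Fin 2) ℂ := ⟨-1, hmem⟩
  have hρc : (fundamentalRep (Fin 2) c : Matrix (Fin 2) (Fin 2) ℂ) = -1 := rfl
  have hmp : MeasurePreserving (fun U : GaugeConfig 3 L (Matrix.specialUnitaryGroup (Fin 2) ℂ) => update U (x, i) (U (x, i) * c))
      (Measure.pi fun _ : Edge 3 L => haarProbability (Matrix.specialUnitaryGroup (Fin 2) ℂ))
      (Measure.pi fun _ : Edge 3 L => haarProbability (Matrix.specialUnitaryGroup (Fin 2) ℂ)) :=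
    Literature.MathematicalPhysics.QuantumLattice.measurePreserving_update_mul_pi (G := Matrix.specialUnitaryGroup (Fin 2) ℂ)
      ((x, i) : Edge 3 L) (ψ := fun _ => c) measurable_const (fun _ _ => rfl)
  have hne1 : ((Literature.MathematicalPhysics.QuantumFieldTheory.Site.shift x i, j) : Edge 3 L) ≠ (x, i) := fun h => hij (congrArg Prod.snd h).symm
  have hne2 : ((Literature.MathematicalPhysics.QuantumFieldTheory.Site.shift x j, i) : Edge 3 L) ≠ (x, i) := fun h => site_shift_ne_self hL x j (congrArg Prod.fst h)
  have hne3 : ((x, j) : Edge 3 L) ≠ (x, i) := fun h => hij (congrArg Prod.snd h).symm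
  have hflip : ∀ U : GaugeConfig 3 L (Matrix.specialUnitaryGroup (Fin 2) ℂ),
      ((fundamentalRep (Fin 2) (plaquetteHolonomy (update U (x, i) (U (x, i) * c)) x i j) : Matrix (Fin 2) (Fin 2) ℂ)).trace.re =
        -((fundamentalRep (Fin 2) (plaquetteHolonomy U x i j) : Matrix (Fin 2) (Fin 2) ℂ)).trace.re := by
    intro U
    have h0 : update U (x, i) (U (x, i) * c) (x, i) = U (x, i) * c := update_self _ _ _
    have h1 : update U (x, i) (U (x, i) * c) (Literature.MathematicalPhysics.QuantumFieldTheory.Site.shift x i, j) = U (Literature.MathematicalPhysics.QuantumFieldTheory.Site.shift x i, j) := update_of_ne hne1 _ _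
    have h2 : update U (x, i) (U (x, i) * c) (Literature.MathematicalPhysics.QuantumFieldTheory.Site.shift x j, i) = U (Literature.MathematicalPhysics.QuantumFieldTheory.Site.shift x j, i) := update_of_ne hne2 _ _
    have h3 : update U (x, i) (U (x, i) * c) (x, j) = U (x, j) := update_of_ne hne3 _ _
    simp only [plaquetteHolonomy, h0, h1, h2, h3, map_mul, hρc, mul_neg, mul_one, neg_mul, Matrix.trace_neg, Complex.neg_re]
  have hhol : Continuous fun U : GaugeConfig 3 L (Matrix.specialUnitaryGroup (Fin 2) ℂ) => plaquetteHolonomy U x i j := by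
    unfold plaquetteHolonomy; fun_prop
  have hcont : Continuous fun U : GaugeConfig 3 L (Matrix.specialUnitaryGroup (Fin 2) ℂ) => ((fundamentalRep (Fin 2) (plaquetteHolonomy U x i j) : Matrix (Fin 2) (Fin 2) ℂ)).trace.re :=
    Complex.continuous_re.comp ((continuous_subtype_val.comp hhol).matrix_trace)
  have hmeas : Measurable fun U : GaugeConfig 3 L (Matrix.specialUnitaryGroup (Fin 2) ℂ) =>
      ((fundamentalRep (Fin 2) (plaquetteHolonomy U x i j) : Matrix (Fin 2) (Fin 2) ℂ)).trace.re * Φ U := hcont.measurable.mul hΦm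
  have hI := integral_map (μ := (Measure.pi fun _ : Edge 3 L => haarProbability (Matrix.specialUnitaryGroup (Fin 2) ℂ))) hmp.measurable.aemeasurable hmeas.aestronglyMeasurable
  rw [hmp.map_eq] at hI
  have hneg : ∫ U, ((fundamentalRep (Fin 2) (plaquetteHolonomy (update U (x, i) (U (x, i) * c)) x i j) : Matrix (Fin 2) (Fin 2) ℂ)).trace.re * Φ (update U (x, i) (U (x, i) * c))
      ∂(Measure.pi fun _ : Edge 3 L => haarProbability (Matrix.specialUnitaryGroup (Fin 2) ℂ)) =
      -∫ U, ((fundamentalRep (Fin 2) (plaquetteHolonomy U x i j) : Matrix (Fin 2) (Fin 2) ℂ)).trace.re * Φ U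
        ∂(Measure.pi fun _ : Edge 3 L => haarProbability (Matrix.specialUnitaryGroup (Fin 2) ℂ)) := by
    rw [← integral_neg]
    refine integral_congr_ae (ae_of_all _ fun U => ?_)
    simp only [hflip U, hΦ, neg_mul]
  linarith [hI.trans hneg]

/-- ★ **DISTINCT PLAQUETTES ARE HAAR-ORTHOGONAL** (`1 < L`): `∫ Re tr ρ(U_p) · Re tr ρ(U_q) dHaar^⊗E = 0` for `q ≠ p` — a plaquette `q ≠ p = (x; i<j)`
misses the link `(x, i)` or the link `(x, j)` of `p`, and `Re tr U_p` is odd under the centre flip of either. [folklore] -/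
theorem integral_plaquette_mul_plaquette_pi_eq_zero (L : ℕ) [NeZero L] (hL : 1 < L) (p q : Plaquette 3 L) (hpq : q ≠ p) :
    ∫ U, ((fundamentalRep (Fin 2) (plaquetteHolonomy U p.1 p.2.1.1 p.2.1.2) : Matrix (Fin 2) (Fin 2) ℂ)).trace.re *
        ((fundamentalRep (Fin 2) (plaquetteHolonomy U q.1 q.2.1.1 q.2.1.2) : Matrix (Fin 2) (Fin 2) ℂ)).trace.re
      ∂(Measure.pi fun _ : Edge 3 L => haarProbability (Matrix.specialUnitaryGroup (Fin 2) ℂ)) = 0 := by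
  classical
  haveI : Fact (1 < L) := ⟨hL⟩
  obtain ⟨x, ⟨⟨i, j⟩, hij⟩⟩ := p
  obtain ⟨x', ⟨⟨i', j'⟩, hi'j'⟩⟩ := q
  simp only at hij hi'j' ⊢
  have hholq : Continuous fun U : GaugeConfig 3 L (Matrix.specialUnitaryGroup (Fin 2) ℂ) => plaquetteHolonomy U x' i' j' := by
    unfold plaquetteHolonomy; fun_prop
  have hΦm : Measurable fun U : GaugeConfig 3 L (Matrix.specialUnitaryGroup (Fin 2) ℂ) =>
      ((fundamentalRep (Fin 2) (plaquetteHolonomy U x' i' j') : Matrix (Fin 2) (Fin 2) ℂ)).trace.re :=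
    (Complex.continuous_re.comp ((continuous_subtype_val.comp hholq).matrix_trace)).measurable
  by_cases hm1 : (x, i) = (x', i') ∨ (x, i) = (Literature.MathematicalPhysics.QuantumFieldTheory.Site.shift x' i', j') ∨
      (x, i) = (Literature.MathematicalPhysics.QuantumFieldTheory.Site.shift x' j', i') ∨ (x, i) = (x', j')
  swap
  · -- `q` misses the link `(x, i)`: flip it
    push Not at hm1
    refine integral_plaquette_mul_pi_eq_zero_of_update L hL x (ne_of_lt hij) hΦm (fun U g => ?_)
    simp only [plaquetteHolonomy, update_of_ne (Ne.symm hm1.1), update_of_ne (Ne.symm hm1.2.1), update_of_ne (Ne.symm hm1.2.2.1),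
      update_of_ne (Ne.symm hm1.2.2.2)]
  by_cases hm2 : (x, j) = (x', i') ∨ (x, j) = (Literature.MathematicalPhysics.QuantumFieldTheory.Site.shift x' i', j') ∨
      (x, j) = (Literature.MathematicalPhysics.QuantumFieldTheory.Site.shift x' j', i') ∨ (x, j) = (x', j')
  swap
  · -- `q` misses the link `(x, j)`: reverse `p` and flip `(x, j)`
    push Not at hm2
    have hsw : ∀ U : GaugeConfig 3 L (Matrix.specialUnitaryGroup (Fin 2) ℂ),
        ((fundamentalRep (Fin 2) (plaquetteHolonomy U x i j) : Matrix (Fin 2) (Fin 2) ℂ)).trace.re =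
          ((fundamentalRep (Fin 2) (plaquetteHolonomy U x j i) : Matrix (Fin 2) (Fin 2) ℂ)).trace.re :=
      fun U => (re_trace_plaquetteHolonomy_swap U x i j).symm
    simp_rw [hsw]
    refine integral_plaquette_mul_pi_eq_zero_of_update L hL x (ne_of_lt hij).symm hΦm (fun U g => ?_)
    simp only [plaquetteHolonomy, update_of_ne (Ne.symm hm2.1), update_of_ne (Ne.symm hm2.2.1), update_of_ne (Ne.symm hm2.2.2.1),
      update_of_ne (Ne.symm hm2.2.2.2)]
  -- both `(x, i)` and `(x, j)` are links of `q`: then `q = p`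
  exfalso
  have hdir1 : i = i' ∨ i = j' := by
    rcases hm1 with h | h | h | h <;> [exact Or.inl (congrArg Prod.snd h); exact Or.inr (congrArg Prod.snd h);
      exact Or.inl (congrArg Prod.snd h); exact Or.inr (congrArg Prod.snd h)]
  have hdir2 : j = i' ∨ j = j' := by
    rcases hm2 with h | h | h | h <;> [exact Or.inl (congrArg Prod.snd h); exact Or.inr (congrArg Prod.snd h);
      exact Or.inl (congrArg Prod.snd h); exact Or.inr (congrArg Prod.snd h)]
  have key : ∀ a b a' b' : Fin 3, a < b → a' < b' → (a = a' ∨ a = b') → (b = a' ∨ b = b') → a = a' ∧ b = b' := by decide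
  obtain ⟨rfl, rfl⟩ := key i j i' j' hij hi'j' hdir1 hdir2
  have hx1 : x = x' ∨ x = Literature.MathematicalPhysics.QuantumFieldTheory.Site.shift x' j := by
    rcases hm1 with h | h | h | h
    · exact Or.inl (congrArg Prod.fst h)
    · exact absurd (congrArg Prod.snd h) (ne_of_lt hij)
    · exact Or.inr (congrArg Prod.fst h)
    · exact absurd (congrArg Prod.snd h) (ne_of_lt hij)
  have hx2 : x = Literature.MathematicalPhysics.QuantumFieldTheory.Site.shift x' i ∨ x = x' := by
    rcases hm2 with h | h | h | h
    · exact absurd (congrArg Prod.snd h).symm (ne_of_lt hij)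
    · exact Or.inl (congrArg Prod.fst h)
    · exact absurd (congrArg Prod.snd h).symm (ne_of_lt hij)
    · exact Or.inr (congrArg Prod.fst h)
  have hxx : x ≠ x' := by
    rintro rfl
    exact hpq rfl
  rcases hx1 with h1 | h1
  · exact hxx h1
  rcases hx2 with h2 | h2
  · exact site_shift_ne_shift hL x' (ne_of_lt hij) (h2.symm.trans h1)
  · exact hxx h2

/-- ★ **THE SQUARED PLAQUETTE TRACE HAS HAAR MEAN ONE** (`1 < L`, `i ≠ j`): `∫ (Re tr ρ(U_(x;i,j)))² dHaar^⊗E = 1` — `U_p = U_(x,i)·ψ(U)` with `ψ` blind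
to the link `(x, i)`, so `U ↦ update U (x,i) (U_(x,i)·ψ(U))` preserves `Haar^⊗E` (`measurePreserving_update_mul_pi`) and `U_p` is Haar distributed;
`∫_(SU(2)) (Re tr U)² dU = 1` (`charVariance_eq_one`). [folklore] -/
theorem integral_plaquette_sq_pi_eq_one (L : ℕ) [NeZero L] (hL : 1 < L) (x : Literature.MathematicalPhysics.QuantumFieldTheory.Site 3 L)
    {i j : Fin 3} (hij : i ≠ j) :
    ∫ U, ((fundamentalRep (Fin 2) (plaquetteHolonomy U x i j) : Matrix (Fin 2) (Fin 2) ℂ)).trace.re ^ 2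
      ∂(Measure.pi fun _ : Edge 3 L => haarProbability (Matrix.specialUnitaryGroup (Fin 2) ℂ)) = 1 := by
  classical
  haveI := secondCountableTopology_su2
  haveI := borelSpace_config L
  haveI : Fact (1 < L) := ⟨hL⟩
  have hne1 : ((Literature.MathematicalPhysics.QuantumFieldTheory.Site.shift x i, j) : Edge 3 L) ≠ (x, i) := fun h => hij (congrArg Prod.snd h).symm
  have hne2 : ((Literature.MathematicalPhysics.QuantumFieldTheory.Site.shift x j, i) : Edge 3 L) ≠ (x, i) := fun h => site_shift_ne_self hL x j (congrArg Prod.fst h)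
  have hne3 : ((x, j) : Edge 3 L) ≠ (x, i) := fun h => hij (congrArg Prod.snd h).symm
  -- the skew product `U ↦ update U (x,i) (U (x,i) · ψ U)`, `ψ U = U_(x+eᵢ,j) U_(x+eⱼ,i)⁻¹ U_(x,j)⁻¹`
  have hψm : Measurable fun U : GaugeConfig 3 L (Matrix.specialUnitaryGroup (Fin 2) ℂ) =>
      U (Literature.MathematicalPhysics.QuantumFieldTheory.Site.shift x i, j) * (U (Literature.MathematicalPhysics.QuantumFieldTheory.Site.shift x j, i))⁻¹ * (U (x, j))⁻¹ := by
    have hc : Continuous fun U : GaugeConfig 3 L (Matrix.specialUnitaryGroup (Fin 2) ℂ) =>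
        U (Literature.MathematicalPhysics.QuantumFieldTheory.Site.shift x i, j) * (U (Literature.MathematicalPhysics.QuantumFieldTheory.Site.shift x j, i))⁻¹ * (U (x, j))⁻¹ := by fun_prop
    exact hc.measurable
  have hψi : ∀ (U : GaugeConfig 3 L (Matrix.specialUnitaryGroup (Fin 2) ℂ)) (g : Matrix.specialUnitaryGroup (Fin 2) ℂ),
      (update U (x, i) g) (Literature.MathematicalPhysics.QuantumFieldTheory.Site.shift x i, j) * ((update U (x, i) g) (Literature.MathematicalPhysics.QuantumFieldTheory.Site.shift x j, i))⁻¹ * ((update U (x, i) g) (x, j))⁻¹ =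
        U (Literature.MathematicalPhysics.QuantumFieldTheory.Site.shift x i, j) * (U (Literature.MathematicalPhysics.QuantumFieldTheory.Site.shift x j, i))⁻¹ * (U (x, j))⁻¹ := by
    intro U g; rw [update_of_ne hne1, update_of_ne hne2, update_of_ne hne3]
  have hmp : MeasurePreserving (fun U : GaugeConfig 3 L (Matrix.specialUnitaryGroup (Fin 2) ℂ) => update U (x, i) (U (x, i) *
      (U (Literature.MathematicalPhysics.QuantumFieldTheory.Site.shift x i, j) * (U (Literature.MathematicalPhysics.QuantumFieldTheory.Site.shift x j, i))⁻¹ * (U (x, j))⁻¹)))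
      (Measure.pi fun _ : Edge 3 L => haarProbability (Matrix.specialUnitaryGroup (Fin 2) ℂ))
      (Measure.pi fun _ : Edge 3 L => haarProbability (Matrix.specialUnitaryGroup (Fin 2) ℂ)) :=
    Literature.MathematicalPhysics.QuantumLattice.measurePreserving_update_mul_pi (G := Matrix.specialUnitaryGroup (Fin 2) ℂ)
      ((x, i) : Edge 3 L) (ψ := fun U : GaugeConfig 3 L (Matrix.specialUnitaryGroup (Fin 2) ℂ) =>
        U (Literature.MathematicalPhysics.QuantumFieldTheory.Site.shift x i, j) * (U (Literature.MathematicalPhysics.QuantumFieldTheory.Site.shift x j, i))⁻¹ * (U (x, j))⁻¹) hψm hψi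
  -- the one-link observable `f U = (Re tr ρ(U_(x,i)))²`
  have hg : Continuous fun g : Matrix.specialUnitaryGroup (Fin 2) ℂ => ((fundamentalRep (Fin 2) g : Matrix (Fin 2) (Fin 2) ℂ)).trace.re ^ 2 :=
    (Complex.continuous_re.comp (continuous_fundamentalRep (Fin 2)).matrix_trace).pow 2
  have hf : Continuous fun U : GaugeConfig 3 L (Matrix.specialUnitaryGroup (Fin 2) ℂ) => ((fundamentalRep (Fin 2) (U (x, i)) : Matrix (Fin 2) (Fin 2) ℂ)).trace.re ^ 2 :=
    hg.comp (continuous_apply _)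
  have hI := integral_map (μ := (Measure.pi fun _ : Edge 3 L => haarProbability (Matrix.specialUnitaryGroup (Fin 2) ℂ))) hmp.measurable.aemeasurable hf.aestronglyMeasurable
  rw [hmp.map_eq] at hI
  have hS : ∀ U : GaugeConfig 3 L (Matrix.specialUnitaryGroup (Fin 2) ℂ), (update U (x, i) (U (x, i) *
      (U (Literature.MathematicalPhysics.QuantumFieldTheory.Site.shift x i, j) * (U (Literature.MathematicalPhysics.QuantumFieldTheory.Site.shift x j, i))⁻¹ * (U (x, j))⁻¹))) (x, i) =
      plaquetteHolonomy U x i j := by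
    intro U; rw [update_self, plaquetteHolonomy, ← mul_assoc, ← mul_assoc]
  have hI' : ∫ U, ((fundamentalRep (Fin 2) (U (x, i)) : Matrix (Fin 2) (Fin 2) ℂ)).trace.re ^ 2 ∂(Measure.pi fun _ : Edge 3 L => haarProbability (Matrix.specialUnitaryGroup (Fin 2) ℂ)) =
      ∫ U, ((fundamentalRep (Fin 2) (plaquetteHolonomy U x i j) : Matrix (Fin 2) (Fin 2) ℂ)).trace.re ^ 2 ∂(Measure.pi fun _ : Edge 3 L => haarProbability (Matrix.specialUnitaryGroup (Fin 2) ℂ)) := by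
    refine hI.trans (integral_congr_ae (ae_of_all _ fun U => ?_))
    simp only [hS U]
  -- the marginal at the link `(x, i)` is Haar
  have hev : MeasurePreserving (Function.eval ((x, i) : Edge 3 L))
      (Measure.pi fun _ : Edge 3 L => haarProbability (Matrix.specialUnitaryGroup (Fin 2) ℂ)) (haarProbability (Matrix.specialUnitaryGroup (Fin 2) ℂ)) :=
    measurePreserving_eval (μ := fun _ : Edge 3 L => haarProbability (Matrix.specialUnitaryGroup (Fin 2) ℂ)) ((x, i) : Edge 3 L)
  have hJ := integral_map (μ := (Measure.pi fun _ : Edge 3 L => haarProbability (Matrix.specialUnitaryGroup (Fin 2) ℂ))) hev.measurable.aemeasurable hg.aestronglyMeasurable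
  rw [hev.map_eq] at hJ
  have hV : ∫ g, ((fundamentalRep (Fin 2) g : Matrix (Fin 2) (Fin 2) ℂ)).trace.re ^ 2 ∂(haarProbability (Matrix.specialUnitaryGroup (Fin 2) ℂ)) = 1 := by
    have h := Literature.MathematicalPhysics.QuantumFieldTheory.HaarMoments.RobustBall.HaarSecondMoments.charVariance_eq_one
      (fundamentalRep (Fin 2)) (Literature.MathematicalPhysics.QuantumFieldTheory.TorusAreaLaw.isSpecialUnitaryModel_fundamentalRep 2)
    unfold PlaquetteLowerBound.charVariance PlaquetteLowerBound.reTr at h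
    exact h
  calc ∫ U, ((fundamentalRep (Fin 2) (plaquetteHolonomy U x i j) : Matrix (Fin 2) (Fin 2) ℂ)).trace.re ^ 2 ∂(Measure.pi fun _ : Edge 3 L => haarProbability (Matrix.specialUnitaryGroup (Fin 2) ℂ))
      = ∫ U, ((fundamentalRep (Fin 2) (U (x, i)) : Matrix (Fin 2) (Fin 2) ℂ)).trace.re ^ 2 ∂(Measure.pi fun _ : Edge 3 L => haarProbability (Matrix.specialUnitaryGroup (Fin 2) ℂ)) := hI'.symm
    _ = ∫ g, ((fundamentalRep (Fin 2) g : Matrix (Fin 2) (Fin 2) ℂ)).trace.re ^ 2 ∂(haarProbability (Matrix.specialUnitaryGroup (Fin 2) ℂ)) := by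
        simpa only [Function.eval] using hJ.symm
    _ = 1 := hV

/-- ★★ **THE STRONG-COUPLING SLOPE OF THE PLAQUETTE IS EXACTLY ONE, FOR EVERY VOLUME** (`1 < L`, every plaquette `p`):
`d/db|_(b=0) ∫ Re tr ρ(U_p) dμ_b = 1` — the first cumulant `−Cov_Haar(Re tr U_p, S_W) = Σ_q ∫ Re tr U_p · Re tr U_q dHaar^⊗E = ∫ (Re tr U_p)² = 1`
(`hasDerivAt_wilson_integral`, file 21; Haar orthogonality of distinct plaquettes; `integral_plaquette_sq_pi_eq_one`): NO finite-volume correction at first order.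
Fixed cut-off; the Yang–Mills mass gap is NOT proved. [folklore; cite: Wilson1974, §III] -/
theorem hasDerivAt_plaquette_expectation_zero (L : ℕ) [NeZero L] (hL : 1 < L) (p : Plaquette 3 L) :
    HasDerivAt (fun b : ℝ => ∫ U, ((fundamentalRep (Fin 2) (plaquetteHolonomy U p.1 p.2.1.1 p.2.1.2) : Matrix (Fin 2) (Fin 2) ℂ)).trace.re
      ∂(wilsonMeasure (d := 3) (L := L) (fundamentalRep (Fin 2)) b)) 1 0 := by
  classical
  haveI := secondCountableTopology_su2
  haveI := borelSpace_config L
  haveI : Fact (1 < L) := ⟨hL⟩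
  have hij : p.2.1.1 ≠ p.2.1.2 := ne_of_lt p.2.2
  have hPc : ∀ q : Plaquette 3 L, Continuous fun U : GaugeConfig 3 L (Matrix.specialUnitaryGroup (Fin 2) ℂ) =>
      ((fundamentalRep (Fin 2) (plaquetteHolonomy U q.1 q.2.1.1 q.2.1.2) : Matrix (Fin 2) (Fin 2) ℂ)).trace.re := by
    intro q
    have hhol : Continuous fun U : GaugeConfig 3 L (Matrix.specialUnitaryGroup (Fin 2) ℂ) => plaquetteHolonomy U q.1 q.2.1.1 q.2.1.2 := by
      unfold plaquetteHolonomy; fun_prop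
    exact Complex.continuous_re.comp ((continuous_subtype_val.comp hhol).matrix_trace)
  obtain ⟨MP, -, hMP⟩ := exists_abs_le_of_continuous (hPc p)
  have hD := hasDerivAt_wilson_integral L 0 (H := fun U : GaugeConfig 3 L (Matrix.specialUnitaryGroup (Fin 2) ℂ) =>
      ((fundamentalRep (Fin 2) (plaquetteHolonomy U p.1 p.2.1.1 p.2.1.2) : Matrix (Fin 2) (Fin 2) ℂ)).trace.re) (hPc p).measurable hMP
  refine hD.congr_deriv ?_
  rw [wilsonMeasure_zero_eq_pi L, integral_plaquette_pi_eq_zero L hL p.1 hij, zero_mul, sub_zero]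
  -- the action through plaquette traces
  have hS : ∀ U : GaugeConfig 3 L (Matrix.specialUnitaryGroup (Fin 2) ℂ), Literature.MathematicalPhysics.QuantumFieldTheory.wilsonAction (fundamentalRep (Fin 2)) U =
      ∑ q : Plaquette 3 L, ((2 : ℝ) - ((fundamentalRep (Fin 2) (plaquetteHolonomy U q.1 q.2.1.1 q.2.1.2) : Matrix (Fin 2) (Fin 2) ℂ)).trace.re) := by
    intro U; unfold Literature.MathematicalPhysics.QuantumFieldTheory.wilsonAction; norm_num
  have hiPP : ∀ q : Plaquette 3 L, Integrable (fun U : GaugeConfig 3 L (Matrix.specialUnitaryGroup (Fin 2) ℂ) =>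
      ((fundamentalRep (Fin 2) (plaquetteHolonomy U p.1 p.2.1.1 p.2.1.2) : Matrix (Fin 2) (Fin 2) ℂ)).trace.re *
        ((fundamentalRep (Fin 2) (plaquetteHolonomy U q.1 q.2.1.1 q.2.1.2) : Matrix (Fin 2) (Fin 2) ℂ)).trace.re)
      (Measure.pi fun _ : Edge 3 L => haarProbability (Matrix.specialUnitaryGroup (Fin 2) ℂ)) := fun q =>
    integrable_of_continuous_of_compactSpace ((hPc p).mul (hPc q)) _
  have hiP2 : ∀ q : Plaquette 3 L, Integrable (fun U : GaugeConfig 3 L (Matrix.specialUnitaryGroup (Fin 2) ℂ) =>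
      ((fundamentalRep (Fin 2) (plaquetteHolonomy U p.1 p.2.1.1 p.2.1.2) : Matrix (Fin 2) (Fin 2) ℂ)).trace.re *
        ((2 : ℝ) - ((fundamentalRep (Fin 2) (plaquetteHolonomy U q.1 q.2.1.1 q.2.1.2) : Matrix (Fin 2) (Fin 2) ℂ)).trace.re))
      (Measure.pi fun _ : Edge 3 L => haarProbability (Matrix.specialUnitaryGroup (Fin 2) ℂ)) := fun q =>
    integrable_of_continuous_of_compactSpace ((hPc p).mul (continuous_const.sub (hPc q))) _
  have hterm : ∀ q : Plaquette 3 L, ∫ U, ((fundamentalRep (Fin 2) (plaquetteHolonomy U p.1 p.2.1.1 p.2.1.2) : Matrix (Fin 2) (Fin 2) ℂ)).trace.re *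
        ((2 : ℝ) - ((fundamentalRep (Fin 2) (plaquetteHolonomy U q.1 q.2.1.1 q.2.1.2) : Matrix (Fin 2) (Fin 2) ℂ)).trace.re)
      ∂(Measure.pi fun _ : Edge 3 L => haarProbability (Matrix.specialUnitaryGroup (Fin 2) ℂ)) =
      -∫ U, ((fundamentalRep (Fin 2) (plaquetteHolonomy U p.1 p.2.1.1 p.2.1.2) : Matrix (Fin 2) (Fin 2) ℂ)).trace.re *
        ((fundamentalRep (Fin 2) (plaquetteHolonomy U q.1 q.2.1.1 q.2.1.2) : Matrix (Fin 2) (Fin 2) ℂ)).trace.re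
      ∂(Measure.pi fun _ : Edge 3 L => haarProbability (Matrix.specialUnitaryGroup (Fin 2) ℂ)) := by
    intro q
    have hpt : ∀ U : GaugeConfig 3 L (Matrix.specialUnitaryGroup (Fin 2) ℂ), ((fundamentalRep (Fin 2) (plaquetteHolonomy U p.1 p.2.1.1 p.2.1.2) : Matrix (Fin 2) (Fin 2) ℂ)).trace.re *
        ((2 : ℝ) - ((fundamentalRep (Fin 2) (plaquetteHolonomy U q.1 q.2.1.1 q.2.1.2) : Matrix (Fin 2) (Fin 2) ℂ)).trace.re) =
        2 * ((fundamentalRep (Fin 2) (plaquetteHolonomy U p.1 p.2.1.1 p.2.1.2) : Matrix (Fin 2) (Fin 2) ℂ)).trace.re -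
          ((fundamentalRep (Fin 2) (plaquetteHolonomy U p.1 p.2.1.1 p.2.1.2) : Matrix (Fin 2) (Fin 2) ℂ)).trace.re *
            ((fundamentalRep (Fin 2) (plaquetteHolonomy U q.1 q.2.1.1 q.2.1.2) : Matrix (Fin 2) (Fin 2) ℂ)).trace.re := fun U => by ring
    simp_rw [hpt]
    rw [integral_sub ((integrable_of_continuous_of_compactSpace (hPc p) _).const_mul 2) (hiPP q), MeasureTheory.integral_const_mul,
      integral_plaquette_pi_eq_zero L hL p.1 hij, mul_zero, zero_sub]
  simp_rw [hS, Finset.mul_sum]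
  rw [integral_finsetSum _ (fun q _ => hiP2 q)]
  simp_rw [hterm]
  rw [Finset.sum_neg_distrib, neg_neg, Finset.sum_eq_single p (fun q _ hq => integral_plaquette_mul_plaquette_pi_eq_zero L hL p q hq)
    (fun h => absurd (Finset.mem_univ p) h)]
  have hsq : ∀ U : GaugeConfig 3 L (Matrix.specialUnitaryGroup (Fin 2) ℂ), ((fundamentalRep (Fin 2) (plaquetteHolonomy U p.1 p.2.1.1 p.2.1.2) : Matrix (Fin 2) (Fin 2) ℂ)).trace.re *
      ((fundamentalRep (Fin 2) (plaquetteHolonomy U p.1 p.2.1.1 p.2.1.2) : Matrix (Fin 2) (Fin 2) ℂ)).trace.re =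
      ((fundamentalRep (Fin 2) (plaquetteHolonomy U p.1 p.2.1.1 p.2.1.2) : Matrix (Fin 2) (Fin 2) ℂ)).trace.re ^ 2 := fun U => by ring
  simp_rw [hsq]
  exact integral_plaquette_sq_pi_eq_one L hL p.1 hij

/-- ★★ **THE SPECIFIC HEAT AT INFINITE TEMPERATURE IS EXACTLY ONE PER PLAQUETTE, FOR EVERY VOLUME** (`1 < L`):
`d/db|_(b=0) ∫ S_W dμ_b = −Var_(Haar^⊗E)(S_W) = −#𝒫 (= −3L³)` — distinct plaquettes are Haar-orthogonal and each has variance one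
(`hasDerivAt_wilson_meanAction`, file 21).  Fixed cut-off; the Yang–Mills mass gap is NOT proved. [folklore; cite: Wilson1974, §III] -/
theorem hasDerivAt_meanAction_zero (L : ℕ) [NeZero L] (hL : 1 < L) :
    HasDerivAt (fun b : ℝ => ∫ U, Literature.MathematicalPhysics.QuantumFieldTheory.wilsonAction (fundamentalRep (Fin 2)) U
      ∂(wilsonMeasure (d := 3) (L := L) (fundamentalRep (Fin 2)) b)) (-(Fintype.card (Plaquette 3 L) : ℝ)) 0 := by
  classical
  haveI := secondCountableTopology_su2
  haveI := borelSpace_config L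
  haveI : Fact (1 < L) := ⟨hL⟩
  have hPc : ∀ q : Plaquette 3 L, Continuous fun U : GaugeConfig 3 L (Matrix.specialUnitaryGroup (Fin 2) ℂ) =>
      ((fundamentalRep (Fin 2) (plaquetteHolonomy U q.1 q.2.1.1 q.2.1.2) : Matrix (Fin 2) (Fin 2) ℂ)).trace.re := by
    intro q
    have hhol : Continuous fun U : GaugeConfig 3 L (Matrix.specialUnitaryGroup (Fin 2) ℂ) => plaquetteHolonomy U q.1 q.2.1.1 q.2.1.2 := by
      unfold plaquetteHolonomy; fun_prop
    exact Complex.continuous_re.comp ((continuous_subtype_val.comp hhol).matrix_trace)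
  have hD := hasDerivAt_wilson_meanAction L 0
  refine hD.congr_deriv ?_
  rw [wilsonMeasure_zero_eq_pi L]
  congr 1
  have hS : ∀ U : GaugeConfig 3 L (Matrix.specialUnitaryGroup (Fin 2) ℂ), Literature.MathematicalPhysics.QuantumFieldTheory.wilsonAction (fundamentalRep (Fin 2)) U =
      ∑ q : Plaquette 3 L, ((2 : ℝ) - ((fundamentalRep (Fin 2) (plaquetteHolonomy U q.1 q.2.1.1 q.2.1.2) : Matrix (Fin 2) (Fin 2) ℂ)).trace.re) := by
    intro U; unfold Literature.MathematicalPhysics.QuantumFieldTheory.wilsonAction; norm_num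
  have hiP : ∀ q : Plaquette 3 L, Integrable (fun U : GaugeConfig 3 L (Matrix.specialUnitaryGroup (Fin 2) ℂ) =>
      ((fundamentalRep (Fin 2) (plaquetteHolonomy U q.1 q.2.1.1 q.2.1.2) : Matrix (Fin 2) (Fin 2) ℂ)).trace.re)
      (Measure.pi fun _ : Edge 3 L => haarProbability (Matrix.specialUnitaryGroup (Fin 2) ℂ)) := fun q =>
    integrable_of_continuous_of_compactSpace (hPc q) _
  have hiPP : ∀ q q' : Plaquette 3 L, Integrable (fun U : GaugeConfig 3 L (Matrix.specialUnitaryGroup (Fin 2) ℂ) =>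
      ((fundamentalRep (Fin 2) (plaquetteHolonomy U q.1 q.2.1.1 q.2.1.2) : Matrix (Fin 2) (Fin 2) ℂ)).trace.re *
        ((fundamentalRep (Fin 2) (plaquetteHolonomy U q'.1 q'.2.1.1 q'.2.1.2) : Matrix (Fin 2) (Fin 2) ℂ)).trace.re)
      (Measure.pi fun _ : Edge 3 L => haarProbability (Matrix.specialUnitaryGroup (Fin 2) ℂ)) := fun q q' =>
    integrable_of_continuous_of_compactSpace ((hPc q).mul (hPc q')) _
  -- the Haar mean of the action is `2·#𝒫`
  have hm : ∫ U, Literature.MathematicalPhysics.QuantumFieldTheory.wilsonAction (fundamentalRep (Fin 2)) U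
      ∂(Measure.pi fun _ : Edge 3 L => haarProbability (Matrix.specialUnitaryGroup (Fin 2) ℂ)) = ∑ q : Plaquette 3 L, (2 : ℝ) := by
    simp_rw [hS]
    rw [integral_finsetSum (s := Finset.univ) (f := fun (q : Plaquette 3 L) (U : GaugeConfig 3 L (Matrix.specialUnitaryGroup (Fin 2) ℂ)) =>
      (2 : ℝ) - ((fundamentalRep (Fin 2) (plaquetteHolonomy U q.1 q.2.1.1 q.2.1.2) : Matrix (Fin 2) (Fin 2) ℂ)).trace.re)
      (fun q _ => (integrable_const (2 : ℝ)).sub (hiP q))]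
    refine Finset.sum_congr rfl fun q _ => ?_
    rw [integral_sub (integrable_const _) (hiP q), integral_plaquette_pi_eq_zero L hL q.1 (ne_of_lt q.2.2), sub_zero,
      MeasureTheory.integral_const, smul_eq_mul, probReal_univ, one_mul]
  have hcen : ∀ U : GaugeConfig 3 L (Matrix.specialUnitaryGroup (Fin 2) ℂ), Literature.MathematicalPhysics.QuantumFieldTheory.wilsonAction (fundamentalRep (Fin 2)) U -
      ∫ V, Literature.MathematicalPhysics.QuantumFieldTheory.wilsonAction (fundamentalRep (Fin 2)) V ∂(Measure.pi fun _ : Edge 3 L => haarProbability (Matrix.specialUnitaryGroup (Fin 2) ℂ)) =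
      -∑ q : Plaquette 3 L, ((fundamentalRep (Fin 2) (plaquetteHolonomy U q.1 q.2.1.1 q.2.1.2) : Matrix (Fin 2) (Fin 2) ℂ)).trace.re := by
    intro U
    rw [hm, hS U, ← Finset.sum_sub_distrib, ← Finset.sum_neg_distrib]
    refine Finset.sum_congr rfl fun q _ => ?_
    ring
  simp_rw [hcen, neg_sq, sq, Finset.sum_mul_sum]
  rw [integral_finsetSum _ (fun q _ => integrable_finsetSum _ (fun q' _ => hiPP q q'))]
  rw [Finset.sum_congr rfl (fun q _ => integral_finsetSum _ (fun q' _ => hiPP q q'))]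
  have hdiag : ∀ q : Plaquette 3 L, ∑ q' : Plaquette 3 L, ∫ U, ((fundamentalRep (Fin 2) (plaquetteHolonomy U q.1 q.2.1.1 q.2.1.2) : Matrix (Fin 2) (Fin 2) ℂ)).trace.re *
        ((fundamentalRep (Fin 2) (plaquetteHolonomy U q'.1 q'.2.1.1 q'.2.1.2) : Matrix (Fin 2) (Fin 2) ℂ)).trace.re
      ∂(Measure.pi fun _ : Edge 3 L => haarProbability (Matrix.specialUnitaryGroup (Fin 2) ℂ)) = 1 := by
    intro q
    rw [Finset.sum_eq_single q (fun q' _ hq' => integral_plaquette_mul_plaquette_pi_eq_zero L hL q q' hq') (fun h => absurd (Finset.mem_univ q) h)]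
    have hsq : ∀ U : GaugeConfig 3 L (Matrix.specialUnitaryGroup (Fin 2) ℂ), ((fundamentalRep (Fin 2) (plaquetteHolonomy U q.1 q.2.1.1 q.2.1.2) : Matrix (Fin 2) (Fin 2) ℂ)).trace.re *
        ((fundamentalRep (Fin 2) (plaquetteHolonomy U q.1 q.2.1.1 q.2.1.2) : Matrix (Fin 2) (Fin 2) ℂ)).trace.re =
        ((fundamentalRep (Fin 2) (plaquetteHolonomy U q.1 q.2.1.1 q.2.1.2) : Matrix (Fin 2) (Fin 2) ℂ)).trace.re ^ 2 := fun U => by ring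
    simp_rw [hsq]
    exact integral_plaquette_sq_pi_eq_one L hL q.1 (ne_of_lt q.2.2)
  simp_rw [hdiag]
  simp

end Summit.QuantumFields.YangMills.Theorems.ColdStartUniversality.LiebRobinson
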